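import Mathlib
import Literature.Computability.AlgebraicComplexity.LaserMethodTypeCount

/-!
# `RectangularThmB` (crux stmt-MatrixMultiplication-10597, route ThinBlockAlpha):
# the null-offset chart over `ℤ/9` — support `S`, distribution `τ`, tight labels, entropy bookkeeping

Negative-side support file for the refutation of `ThinBlockAlpha.RectangularThmB`; `sorry`-free.  These are
the inputs of the tree's hashing/type-count theorem `exists_free_diagonal_jointType_card`:

* `nullS` — the support `S ⊆ Fin 2 × Fin 2 × Fin 3` = the profiles `(Q₁, Q₂, Q₃)` of the symbols
  `a, b, c, o`; `nullP` — the composition `τ = (7/18, 1/9, 7/18, 1/9)` transported to `S`;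
  `nullQ m` — the joint type `(7m, 2m, 7m, 2m)` for word length `18 m` (`sum_nullQ`, `nullP_eq_div`).
* `labα, labβ, labγ` — the `b`-tight labels `α = (0,1)`, `β = (1,0)`, `γ = (−1,0,−2)` (injective, sum `0`
  on `S`: `lab_tight`).
* `nullChart_entropy` — the three marginal entropies of `τ` are `1, 1, h₀` with
  `h₀ = log₂ 9 − (7/9) log₂ 7` (the third EXACTLY), and the max-entropy penalty of `τ` vanishes because `τ`
  is the only distribution supported in `S` with its marginals (`eq_nullP_of_mem`).
-/

set_option linter.dupNamespace false

noncomputable section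

namespace Summit.MatrixMultiplication.MatrixMultiplication.Theorems.RectangularThmB.Negative

open Literature.Computability.AlgebraicComplexity

/-! ### The support, the distribution, the joint type -/

/-- The support `S` = profiles of the four symbols `a, b, c, o`. -/
def nullS : Finset (Fin 2 × Fin 2 × Fin 3) := {(0, 0, 0), (0, 1, 1), (1, 1, 0), (1, 0, 2)}

/-- The distribution `τ` transported to `S`. -/
def nullP : Fin 2 × Fin 2 × Fin 3 → ℝ := fun p =>
  if p = (0, 0, 0) then 7 / 18 else if p = (0, 1, 1) then 1 / 9 else
  if p = (1, 1, 0) then 7 / 18 else if p = (1, 0, 2) then 1 / 9 else 0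

/-- The joint type on `S` for word length `18 m`: `7m, 2m, 7m, 2m` on the profiles of `a, b, c, o`. -/
def nullQ (m : ℕ) : Fin 2 × Fin 2 × Fin 3 → ℕ := fun p =>
  if p = (0, 0, 0) then 7 * m else if p = (0, 1, 1) then 2 * m else
  if p = (1, 1, 0) then 7 * m else if p = (1, 0, 2) then 2 * m else 0

/-- `nullQ m` vanishes off `S`. -/
theorem nullQ_eq_zero_of_not_mem (m : ℕ) (p : Fin 2 × Fin 2 × Fin 3) (hp : p ∉ nullS) :
    nullQ m p = 0 := by
  simp only [nullS, Finset.mem_insert, Finset.mem_singleton, not_or] at hp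
  simp only [nullQ, hp.1, hp.2.1, hp.2.2.1, hp.2.2.2, if_false]

/-- `nullQ m` has total mass `18 m`. -/
theorem sum_nullQ (m : ℕ) : ∑ p, nullQ m p = 18 * m := by
  rw [← Finset.sum_subset (Finset.subset_univ nullS)
    (fun p _ hp => nullQ_eq_zero_of_not_mem m p hp)]
  simp only [nullS]
  rw [Finset.sum_insert (by decide), Finset.sum_insert (by decide), Finset.sum_insert (by decide),
    Finset.sum_singleton]
  simp only [nullQ]
  simp (config := { decide := true }) only [if_true, if_false]
  ring

/-- `nullP = nullQ m / (18 m)` for `m ≥ 1`. -/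
theorem nullP_eq_div (m : ℕ) (hm : 1 ≤ m) (p : Fin 2 × Fin 2 × Fin 3) :
    nullP p = (nullQ m p : ℝ) / ((18 * m : ℕ) : ℝ) := by
  have h18 : ((18 * m : ℕ) : ℝ) ≠ 0 := by
    have : (18 * m : ℕ) ≠ 0 := by omega
    exact_mod_cast this
  rw [eq_div_iff h18]
  simp only [nullP, nullQ]
  split_ifs <;> push_cast <;> ring

/-! ### Tight labels -/

/-- Tight labels: `α = (0, 1)` on `Q₁`-classes. -/
def labα : Fin 2 → Fin 1 → ℤ := fun i _ => if i = 0 then 0 else 1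
/-- Tight labels: `β = (1, 0)` on `Q₂`-classes. -/
def labβ : Fin 2 → Fin 1 → ℤ := fun j _ => if j = 0 then 1 else 0
/-- Tight labels: `γ = (-1, 0, -2)` on `Q₃`-classes. -/
def labγ : Fin 3 → Fin 1 → ℤ := fun l _ => if l = 0 then -1 else if l = 1 then 0 else -2

/-- `α` is injective. -/
theorem labα_injective : Function.Injective labα := by
  intro i i' h
  have := congrFun h 0
  fin_cases i <;> fin_cases i' <;> simp_all (config := { decide := true })

/-- `β` is injective. -/
theorem labβ_injective : Function.Injective labβ := by
  intro i i' h
  have := congrFun h 0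
  fin_cases i <;> fin_cases i' <;> simp_all (config := { decide := true })

/-- `γ` is injective. -/
theorem labγ_injective : Function.Injective labγ := by
  intro i i' h
  have := congrFun h 0
  fin_cases i <;> fin_cases i' <;> simp_all (config := { decide := true })

/-- Tightness: `α + β + γ = 0` on `S`. -/
theorem lab_tight : ∀ s ∈ nullS, ∀ ρ : Fin 1, labα s.1 ρ + labβ s.2.1 ρ + labγ s.2.2 ρ = 0 := by
  intro s hs ρ
  simp only [labα, labβ, labγ]
  revert s
  decide

/-! ### Values of `nullP` -/

/-- `nullP` vanishes off `S`. -/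
theorem nullP_off (p : Fin 2 × Fin 2 × Fin 3) (hp : p ∉ nullS) : nullP p = 0 := by
  simp only [nullS, Finset.mem_insert, Finset.mem_singleton, not_or] at hp
  simp only [nullP, hp.1, hp.2.1, hp.2.2.1, hp.2.2.2, if_false]

/-- Value at the profile of `a`. -/
theorem nullP_000 : nullP (0, 0, 0) = 7 / 18 := by simp [nullP]
/-- Value at the profile of `b`. -/
theorem nullP_011 : nullP (0, 1, 1) = 1 / 9 := by simp [nullP]
/-- Value at the profile of `c`. -/
theorem nullP_110 : nullP (1, 1, 0) = 7 / 18 := by simp [nullP]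
/-- Value at the profile of `o`. -/
theorem nullP_102 : nullP (1, 0, 2) = 1 / 9 := by simp [nullP]
/-- Off-support value. -/
theorem nullP_001 : nullP (0, 0, 1) = 0 := nullP_off _ (by decide)
/-- Off-support value. -/
theorem nullP_002 : nullP (0, 0, 2) = 0 := nullP_off _ (by decide)
/-- Off-support value. -/
theorem nullP_010 : nullP (0, 1, 0) = 0 := nullP_off _ (by decide)
/-- Off-support value. -/
theorem nullP_012 : nullP (0, 1, 2) = 0 := nullP_off _ (by decide)
/-- Off-support value. -/
theorem nullP_100 : nullP (1, 0, 0) = 0 := nullP_off _ (by decide)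
/-- Off-support value. -/
theorem nullP_101 : nullP (1, 0, 1) = 0 := nullP_off _ (by decide)
/-- Off-support value. -/
theorem nullP_111 : nullP (1, 1, 1) = 0 := nullP_off _ (by decide)
/-- Off-support value. -/
theorem nullP_112 : nullP (1, 1, 2) = 0 := nullP_off _ (by decide)

/-- `nullP ≥ 0`. -/
theorem nullP_nonneg (p : Fin 2 × Fin 2 × Fin 3) : 0 ≤ nullP p := by
  unfold nullP
  split_ifs <;> norm_num

/-- `nullP` has total mass `1`. -/
theorem sum_nullP : ∑ p, nullP p = 1 := by
  rw [Fintype.sum_prod_type, Fin.sum_univ_two, Fintype.sum_prod_type, Fintype.sum_prod_type,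
    Fin.sum_univ_two, Fin.sum_univ_two, Fin.sum_univ_three, Fin.sum_univ_three, Fin.sum_univ_three,
    Fin.sum_univ_three, nullP_000, nullP_001, nullP_002, nullP_010, nullP_011, nullP_012, nullP_100,
    nullP_101, nullP_102, nullP_110, nullP_111, nullP_112]
  norm_num

/-- `nullP` is a probability distribution. -/
theorem nullP_mem_stdSimplex : nullP ∈ stdSimplex ℝ (Fin 2 × Fin 2 × Fin 3) :=
  ⟨nullP_nonneg, sum_nullP⟩

/-! ### Marginals and their entropies -/

/-- First marginal: `(1/2, 1/2)`. -/
theorem marginalDist₁_nullP : marginalDist₁ nullP = fun _ => 1 / 2 := by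
  funext a
  simp only [marginalDist₁, Fin.sum_univ_two, Fin.sum_univ_three]
  fin_cases a
  · simp only [Fin.zero_eta, Fin.isValue, nullP_000, nullP_001, nullP_002, nullP_010, nullP_011,
      nullP_012]
    norm_num
  · simp only [Fin.mk_one, Fin.isValue, nullP_100, nullP_101, nullP_102, nullP_110, nullP_111,
      nullP_112]
    norm_num

/-- Second marginal: `(1/2, 1/2)`. -/
theorem marginalDist₂_nullP : marginalDist₂ nullP = fun _ => 1 / 2 := by
  funext b
  simp only [marginalDist₂, Fin.sum_univ_two, Fin.sum_univ_three]
  fin_cases b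
  · simp only [Fin.zero_eta, Fin.isValue, nullP_000, nullP_001, nullP_002, nullP_100, nullP_101,
      nullP_102]
    norm_num
  · simp only [Fin.mk_one, Fin.isValue, nullP_010, nullP_011, nullP_012, nullP_110, nullP_111,
      nullP_112]
    norm_num

/-- Third marginal: `(7/9, 1/9, 1/9)`. -/
theorem marginalDist₃_nullP :
    marginalDist₃ nullP = fun c => if c = 0 then 7 / 9 else 1 / 9 := by
  funext c
  simp only [marginalDist₃, Fin.sum_univ_two]
  fin_cases c
  · simp only [Fin.zero_eta, Fin.isValue, nullP_000, nullP_010, nullP_100, nullP_110]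
    norm_num
  · simp only [Fin.mk_one, Fin.isValue, nullP_001, nullP_011, nullP_101, nullP_111]
    norm_num
  · have h2 : (2 : Fin 3) ≠ 0 := by decide
    simp only [Fin.reduceFinMk, Fin.isValue, nullP_002, nullP_012, nullP_102, nullP_112, h2, if_false]
    norm_num

/-- `H(1/2, 1/2) = 1` bit. -/
theorem shannonEntropy_half : shannonEntropy (fun _ : Fin 2 => (1 / 2 : ℝ)) = 1 := by
  have hlog2 : 0 < Real.log 2 := Real.log_pos one_lt_two
  simp only [shannonEntropy, Real.negMulLog, Fin.sum_univ_two, one_div, Real.log_inv]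
  field_simp
  ring

/-- `h₀ = log₂ 9 - (7/9) log₂ 7 ≤ 1`, i.e. `9⁹ ≤ 2⁹ · 7⁷`. -/
theorem h0_le_one : Real.logb 2 9 - 7 / 9 * Real.logb 2 7 ≤ 1 := by
  have hlog2 : 0 < Real.log 2 := Real.log_pos one_lt_two
  have h9 : Real.log ((9 : ℝ) ^ 9) = 9 * Real.log 9 := by
    rw [Real.log_pow]; norm_num
  have h2 : Real.log ((2 : ℝ) ^ 9) = 9 * Real.log 2 := by
    rw [Real.log_pow]; norm_num
  have h7 : Real.log ((7 : ℝ) ^ 7) = 7 * Real.log 7 := by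
    rw [Real.log_pow]; norm_num
  have hle : Real.log ((9 : ℝ) ^ 9) ≤ Real.log ((2 : ℝ) ^ 9 * (7 : ℝ) ^ 7) :=
    Real.log_le_log (by positivity) (by norm_num)
  rw [Real.log_mul (by positivity) (by positivity), h9, h2, h7] at hle
  have e : Real.logb 2 9 - 7 / 9 * Real.logb 2 7 = (Real.log 9 - 7 / 9 * Real.log 7) / Real.log 2 := by
    rw [Real.logb, Real.logb]; ring
  rw [e, div_le_one hlog2]
  linarith

/-- The third marginal entropy is EXACTLY `h₀ = log₂ 9 - (7/9) log₂ 7`. -/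
theorem shannonEntropy_marginal₃ :
    shannonEntropy (fun c : Fin 3 => if c = 0 then (7 / 9 : ℝ) else 1 / 9) =
      Real.logb 2 9 - 7 / 9 * Real.logb 2 7 := by
  have hlog2 : (Real.log 2) ≠ 0 := (Real.log_pos one_lt_two).ne'
  simp only [shannonEntropy, Fin.sum_univ_three, Fin.isValue, if_true,
    (by decide : (1 : Fin 3) ≠ 0), (by decide : (2 : Fin 3) ≠ 0), if_false]
  rw [Real.negMulLog, Real.negMulLog, Real.log_div (by norm_num) (by norm_num), one_div,
    Real.log_inv, Real.logb, Real.logb]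
  field_simp
  ring

/-! ### The penalty: `nullP` is alone in its class `D` -/

/-- `nullP` is the only distribution supported in `S` with its three marginals. -/
theorem eq_nullP_of_mem {P : Fin 2 × Fin 2 × Fin 3 → ℝ} (hP : P ∈ sameMarginalsOn nullS nullP) :
    P = nullP := by
  obtain ⟨-, hoff, h1, -, h3⟩ := hP
  have z001 : P (0, 0, 1) = 0 := hoff _ (by decide)
  have z002 : P (0, 0, 2) = 0 := hoff _ (by decide)
  have z010 : P (0, 1, 0) = 0 := hoff _ (by decide)
  have z012 : P (0, 1, 2) = 0 := hoff _ (by decide)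
  have z100 : P (1, 0, 0) = 0 := hoff _ (by decide)
  have z101 : P (1, 0, 1) = 0 := hoff _ (by decide)
  have z111 : P (1, 1, 1) = 0 := hoff _ (by decide)
  have z112 : P (1, 1, 2) = 0 := hoff _ (by decide)
  have e10 := congrFun h1 0
  have e11 := congrFun h1 1
  have e31 := congrFun h3 1
  have e32 := congrFun h3 2
  simp only [marginalDist₁, marginalDist₃, Fin.sum_univ_two, Fin.sum_univ_three, Fin.isValue,
    nullP_000, nullP_001, nullP_002, nullP_010, nullP_011, nullP_012, nullP_100, nullP_101, nullP_102,
    nullP_110, nullP_111, nullP_112, z001, z002, z010, z012, z100, z101, z111, z112] at e10 e11 e31 e32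
  have v011 : P (0, 1, 1) = 1 / 9 := by linarith
  have v102 : P (1, 0, 2) = 1 / 9 := by linarith
  have v000 : P (0, 0, 0) = 7 / 18 := by linarith
  have v110 : P (1, 1, 0) = 7 / 18 := by linarith
  funext p
  by_cases hp : p ∈ nullS
  · simp only [nullS, Finset.mem_insert, Finset.mem_singleton] at hp
    rcases hp with rfl | rfl | rfl | rfl
    · rw [v000, nullP_000]
    · rw [v011, nullP_011]
    · rw [v110, nullP_110]
    · rw [v102, nullP_102]
  · rw [hoff p hp, nullP_off p hp]

/-- The max-entropy penalty of `τ` on `S` vanishes. -/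
theorem maxEntropyPenalty_nullP_le : maxEntropyPenalty nullS nullP ≤ 0 := by
  have hmem : nullP ∈ sameMarginalsOn nullS nullP :=
    self_mem_sameMarginalsOn nullP_mem_stdSimplex nullP_off
  have hne : (shannonEntropy '' sameMarginalsOn nullS nullP).Nonempty := ⟨_, nullP, hmem, rfl⟩
  have hle : sSup (shannonEntropy '' sameMarginalsOn nullS nullP) ≤ shannonEntropy nullP := by
    refine csSup_le hne ?_
    rintro y ⟨P, hP, rfl⟩
    rw [eq_nullP_of_mem hP]
  unfold maxEntropyPenalty maxEntropyGivenMarginals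
  linarith

/-- **Entropy bookkeeping**: the three marginal entropies of `τ` on `S` are at least
`h₀ = log₂ 9 - (7/9) log₂ 7` (they are `1, 1, h₀`) and the max-entropy penalty of `τ` vanishes. -/
theorem nullChart_entropy :
    Real.logb 2 9 - 7 / 9 * Real.logb 2 7 ≤ shannonEntropy (marginalDist₁ nullP) ∧
    Real.logb 2 9 - 7 / 9 * Real.logb 2 7 ≤ shannonEntropy (marginalDist₂ nullP) ∧
    Real.logb 2 9 - 7 / 9 * Real.logb 2 7 ≤ shannonEntropy (marginalDist₃ nullP) ∧
    maxEntropyPenalty nullS nullP ≤ 0 := by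
  refine ⟨?_, ?_, ?_, maxEntropyPenalty_nullP_le⟩
  · rw [marginalDist₁_nullP, shannonEntropy_half]; exact h0_le_one
  · rw [marginalDist₂_nullP, shannonEntropy_half]; exact h0_le_one
  · rw [marginalDist₃_nullP, shannonEntropy_marginal₃]

end Summit.MatrixMultiplication.MatrixMultiplication.Theorems.RectangularThmB.Negative
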